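import Mathlib.CategoryTheory.Limits.Shapes.Equalizers
import Mathlib.CategoryTheory.Limits.HasLimits
import Mathlib.CategoryTheory.Adjunction.Limits
import Mathlib.CategoryTheory.Limits.FunctorCategory.Basic
import Mathlib.CategoryTheory.Limits.Preserves.Basic
import Mathlib.CategoryTheory.Whiskering
import HarnessLib

/-!
# Semi-graphs of anabelioids, Appendix, Theorem A.4 (existence, Čech route): the extension
# `ψ^* := colim ∘ (F ∘ Čech nerve)` of a functor along a Čech presentation — pure category theory

Mochizuki, *Semi-graphs of anabelioids*, Publ. RIMS **42** (2006) 221–322, Appendix, Theorem A.4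
(manuscript pp. 82–86) [cite: MochizukiSemiAnbd2006, Thm A.4 pp.82-86]: a morphism of connected
quasi-temperoids `φ : T₁[A₁] → T₂[A₂]` extends to a morphism of temperoids `ψ : T₁ → T₂`, i.e.
`φ^* : T₂[A₂] ⥤ T₁[A₁]` extends, up to isomorphism on `T₂[A₂]`, to a functor `ψ^* : T₂ ⥤ T₁`
preserving finite limits and countable colimits.  The print route (pp. 83–85, QD-pairs) is typed in
the `BTempQDPair*` files; this file belongs to the CECH ROUTE to the same statement (row A4-∃ of
`plan/L3/SUBDAG-SemiAnbd-Cor311.md`, owner abc-iut-w4-d110; engine binder fixed by abc-iut-w5-d129's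
`ThmA4Chart.thmA4_of_engine′`, `QuasiTemperoidsThmA4OfEngine.lean`): every `X ∈ T₂` is the
coequalizer of its Čech nerve `X × A₂ × A₂ ⇉ X × A₂`, whose terms lie in `T₂[A₂]`, so one DEFINES
`ψ^*(X) := coeq(φ^*(X × A₂ × A₂) ⇉ φ^*(X × A₂))` in `T₁`.

This file is the PURE CATEGORY THEORY of that definition, over an abstract **Čech presentation**
of a category `C` along a functor `ι : Q ⥤ C` (`ThmA4Cech.CechPresentation`: a nerve
`C ⥤ (WalkingParallelPair ⥤ Q)` together with colimit cocones `nerve(ι B) → B` natural in `B : Q`;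
for `B^temp(Π)` and `Q = T[A]` it is instantiated by the Čech nerve of `X × A → X`, companion file
`BTempCechNerve.lean`):

* `CechPresentation.extension P H : C ⥤ C'` — `X ↦ colim (H ∘ nerve X)` for `H : Q ⥤ C'`
  (`H = φ^* ⋙ ι₁`), `C'` with coequalizers;
* **`CechPresentation.extensionIso`** — `ι ⋙ extension P H ≅ H` as soon as `H` preserves the
  presenting colimits (the 1-commutativity `ψ^*|_{T₂[A₂]} ≅ φ^*` of Thm. A.4);
* **`CechPresentation.extension_preservesColimitsOfShape`** — `extension P H` preserves colimits of
  shape `J` as soon as each `X ↦ H(nerve(X)_j)` does (`colim` is a left adjoint; colimits in functor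
  categories into `C'` are pointwise) — the countable-colimit clause of "`ψ` is a morphism of
  temperoids".

The INSTANTIATION at `C = B^temp(Π₂)`, `Q = T₂[A₂]`, `H = φ^* ⋙ ι₁` (sub-DAG cut of abc-iut-w5-d129,
03:36Z: files E1 `BTempCechNerve.lean` — the Čech nerve as a `CechPresentation` — and E2
`QuasiTemperoidsThmA4CechExtension.lean` — `Ψ F := extension`, `α F := extensionIso.symm`), the
finite-limit clause (E3, terminal object and pullbacks at set level in `B^temp(Π₁)`) and the assembly
into `ThmA4` (E4) are companions.  Elementary; nothing refers to the IUT corpus; no side is taken on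
any disputed claim.
-/

open CategoryTheory CategoryTheory.Limits

namespace Literature.AnabelianGeometry.SemiGraphs

namespace ThmA4Cech

universe v₁ v₂ v₃ u₁ u₂ u₃

variable {C : Type u₁} [Category.{v₁} C] {Q : Type u₂} [Category.{v₂} Q]

/-- **A Čech presentation of `C` along `ι : Q ⥤ C`**: a functorial parallel pair `nerve X ⇉` in `Q`
for every `X ∈ C`, and for every `B ∈ Q` a colimit cocone `nerve(ι B) → B` (in `Q`), natural in `B`.
For a connected quasi-temperoid `Q = T[A] ⊆ T = C`: `nerve X = (X × A × A ⇉ X × A)` and the cocone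
is the projection `B × A → B`, "the coequalizer of the two projections `(X × A) ×_X (X × A) ⇉ X × A`"
(proof of the uniqueness half of Thm. A.4 in the tree, `QuasiTemperoidsThmA4Unique.lean`).
[cite: MochizukiSemiAnbd2006, Thm A.4 pp.82-86] -/
structure CechPresentation (ι : Q ⥤ C) where
  /-- the nerve `X ↦ (nerve X : WalkingParallelPair ⥤ Q)` -/
  nerve : C ⥤ (WalkingParallelPair ⥤ Q)
  /-- the augmentation `nerve(ι B) → B`, a cocone with vertex `B` -/
  cocone : ∀ B : Q, nerve.obj (ι.obj B) ⟶ (Functor.const WalkingParallelPair).obj B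
  /-- the augmentation is natural in `B` -/
  naturality : ∀ {B B' : Q} (f : B ⟶ B'),
    nerve.map (ι.map f) ≫ cocone B' = cocone B ≫ (Functor.const WalkingParallelPair).map f
  /-- the augmented nerve of `ι B` is a colimit cocone in `Q` -/
  isColimit : ∀ B : Q, IsColimit (Cocone.mk B (cocone B))

namespace CechPresentation

variable {ι : Q ⥤ C} (P : CechPresentation ι) {C' : Type u₃} [Category.{v₃} C'] (H : Q ⥤ C')

/-- The augmentation component `nerve(ι B)_j → B`, as an arrow into `B`.
[cite: MochizukiSemiAnbd2006, Thm A.4 pp.82-86] -/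
def aug (B : Q) (j : WalkingParallelPair) : (P.nerve.obj (ι.obj B)).obj j ⟶ B := (P.cocone B).app j

/-- `aug` is the cocone component. [cite: MochizukiSemiAnbd2006, Thm A.4 pp.82-86] -/
theorem aug_eq (B : Q) (j : WalkingParallelPair) : P.aug B j = (P.cocone B).app j := rfl

/-- The augmentation, componentwise: naturality in `B`. [cite: MochizukiSemiAnbd2006, Thm A.4 pp.82-86] -/
theorem naturality_app {B B' : Q} (f : B ⟶ B') (j : WalkingParallelPair) :
    (P.nerve.map (ι.map f)).app j ≫ P.aug B' j = P.aug B j ≫ f :=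
  NatTrans.congr_app (P.naturality f) j

/-- The functor `X ↦ (H(nerve X) : WalkingParallelPair ⥤ C')` — "apply `φ^*` (and the inclusion
`T₁[A₁] ⊆ T₁`) to the Čech nerve". [cite: MochizukiSemiAnbd2006, Thm A.4 pp.82-86] -/
def pairs : C ⥤ (WalkingParallelPair ⥤ C') :=
  P.nerve ⋙ (Functor.whiskeringRight WalkingParallelPair Q C').obj H

/-- `pairs` on objects. [cite: MochizukiSemiAnbd2006, Thm A.4 pp.82-86] -/
@[simp] theorem pairs_obj (X : C) : (P.pairs H).obj X = P.nerve.obj X ⋙ H := rfl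

/-- `pairs` on morphisms. [cite: MochizukiSemiAnbd2006, Thm A.4 pp.82-86] -/
@[simp] theorem pairs_map {X Y : C} (f : X ⟶ Y) :
    (P.pairs H).map f = Functor.whiskerRight (P.nerve.map f) H := rfl

/-- `X ↦ H(nerve X)` preserves colimits of shape `J` as soon as it does after evaluation at both
objects of the walking parallel pair (colimits in `WalkingParallelPair ⥤ C'` are computed pointwise).
[cite: MochizukiSemiAnbd2006, Thm A.4 pp.82-86] -/
theorem pairs_preservesColimitsOfShape (J : Type*) [Category J] [HasColimitsOfShape J C']
    (h : ∀ j : WalkingParallelPair,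
      PreservesColimitsOfShape J (P.nerve ⋙ (evaluation WalkingParallelPair Q).obj j ⋙ H)) :
    PreservesColimitsOfShape J (P.pairs H) := by
  refine preservesColimitsOfShape_of_evaluation _ J fun j => ?_
  haveI := h j
  exact preservesColimitsOfShape_of_natIso
    (NatIso.ofComponents (fun X => Iso.refl _) (fun f => by
      change H.map ((P.nerve.map f).app j) ≫ 𝟙 _ = 𝟙 _ ≫ H.map ((P.nerve.map f).app j)
      rw [Category.comp_id, Category.id_comp]) :
      P.nerve ⋙ (evaluation WalkingParallelPair Q).obj j ⋙ H ≅
        P.pairs H ⋙ (evaluation WalkingParallelPair C').obj j)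

variable [HasColimitsOfShape WalkingParallelPair C']

/-- **The Čech extension `ψ^* : C ⥤ C'`**, `X ↦ colim H(nerve X)` ("`ψ^*(X) :=` the coequalizer in
`T₁` of `φ^*(X × A₂ × A₂) ⇉ φ^*(X × A₂)`"). [cite: MochizukiSemiAnbd2006, Thm A.4 pp.82-86] -/
noncomputable def extension : C ⥤ C' := P.pairs H ⋙ colim

/-- `ψ^*` on objects is the colimit of the image pair. [cite: MochizukiSemiAnbd2006, Thm A.4 pp.82-86] -/
theorem extension_obj (X : C) : (P.extension H).obj X = colimit (P.nerve.obj X ⋙ H) := rfl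

/-- `ψ^*` on morphisms is the induced map of colimits. [cite: MochizukiSemiAnbd2006, Thm A.4 pp.82-86] -/
theorem extension_map {X Y : C} (f : X ⟶ Y) :
    (P.extension H).map f = colimMap (Functor.whiskerRight (P.nerve.map f) H) := rfl

/-- **`ψ^*` preserves colimits of shape `J`** whenever `X ↦ H(nerve(X)_j)` does for `j = 0, 1`
(`ψ^* = colim ∘ pairs` and `colim` is a left adjoint) — the countable-colimit clause of "`ψ` is a
morphism of temperoids" reduces to: `(− × A₂)`, `(− × A₂ × A₂)` and `φ^*` preserve countable
colimits. [cite: MochizukiSemiAnbd2006, Thm A.4 pp.82-86] -/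
theorem extension_preservesColimitsOfShape (J : Type*) [Category J] [HasColimitsOfShape J C']
    (h : ∀ j : WalkingParallelPair,
      PreservesColimitsOfShape J (P.nerve ⋙ (evaluation WalkingParallelPair Q).obj j ⋙ H)) :
    PreservesColimitsOfShape J (P.extension H) := by
  haveI := P.pairs_preservesColimitsOfShape H J h
  unfold extension
  infer_instance

/-! ### `ψ^*` restricted to `Q` is `H`: the 1-commutativity of Theorem A.4 -/

section Iso

variable [hH : ∀ B : Q, PreservesColimit (P.nerve.obj (ι.obj B)) H]

/-- The image under `H` of the augmented nerve of `ι B` is a colimit cocone (`H` preserves the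
presenting colimits — for `φ^*`: it preserves countable colimits, and `T₁[A₁] ⊆ T₁` preserves the
colimits `T₁[A₁]` has). [cite: MochizukiSemiAnbd2006, Thm A.4 pp.82-86] -/
noncomputable def isColimitMap (B : Q) : IsColimit (H.mapCocone (Cocone.mk B (P.cocone B))) :=
  isColimitOfPreserves H (P.isColimit B)

/-- The component `ψ^*(ι B) ≅ H B` of the 1-commutativity isomorphism.
[cite: MochizukiSemiAnbd2006, Thm A.4 pp.82-86] -/
noncomputable def extensionIsoApp (B : Q) : colimit (P.nerve.obj (ι.obj B) ⋙ H) ≅ H.obj B :=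
  (colimit.isColimit (P.nerve.obj (ι.obj B) ⋙ H)).coconePointUniqueUpToIso (P.isColimitMap H B)

/-- The component on the colimit injections: `colim.ι_j ≫ (ψ^*(ι B) ≅ H B) = H(augmentation_j)`.
[cite: MochizukiSemiAnbd2006, Thm A.4 pp.82-86] -/
@[simp] theorem colimit_ι_extensionIsoApp_hom (B : Q) (j : WalkingParallelPair) :
    colimit.ι (P.nerve.obj (ι.obj B) ⋙ H) j ≫ (P.extensionIsoApp H B).hom = H.map (P.aug B j) :=
  (colimit.isColimit (P.nerve.obj (ι.obj B) ⋙ H)).comp_coconePointUniqueUpToIso_hom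
    (P.isColimitMap H B) j

/-- Naturality of the components. [cite: MochizukiSemiAnbd2006, Thm A.4 pp.82-86] -/
theorem colimMap_extensionIsoApp_hom {B B' : Q} (f : B ⟶ B') :
    colimMap (Functor.whiskerRight (P.nerve.map (ι.map f)) H) ≫ (P.extensionIsoApp H B').hom =
      (P.extensionIsoApp H B).hom ≫ H.map f := by
  refine colimit.hom_ext fun j => ?_
  rw [ι_colimMap_assoc, colimit_ι_extensionIsoApp_hom, Functor.whiskerRight_app, ← Category.assoc,
    colimit_ι_extensionIsoApp_hom]
  have key : H.map ((P.nerve.map (ι.map f)).app j) ≫ H.map (P.aug B' j) =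
      H.map (P.aug B j) ≫ H.map f := by
    rw [← H.map_comp, naturality_app, H.map_comp]
  exact key

/-- **`ψ^*|_Q ≅ H`**: the Čech extension restricted along `ι` is (naturally isomorphic to) `H` — for
Thm. A.4: `ψ^* ∘ λ₂ ≅ λ₁ ∘ φ^*`, the 1-commutative square. [cite: MochizukiSemiAnbd2006, Thm A.4 pp.82-86] -/
noncomputable def extensionIso : ι ⋙ P.extension H ≅ H :=
  NatIso.ofComponents (fun B => P.extensionIsoApp H B) fun f => P.colimMap_extensionIsoApp_hom H f

/-- The isomorphism on components. [cite: MochizukiSemiAnbd2006, Thm A.4 pp.82-86] -/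
theorem extensionIso_hom_app (B : Q) :
    (P.extensionIso H).hom.app B = (P.extensionIsoApp H B).hom := rfl

end Iso

end CechPresentation

/-! ### The Čech extension on objects as a coequalizer cofork (for the set-level limit computations) -/

section Cofork

open WalkingParallelPair WalkingParallelPairHom

variable {C' : Type u₃} [Category.{v₃} C'] (K : WalkingParallelPair ⥤ C') [HasColimit K]

/-- For any `K : WalkingParallelPair ⥤ C'` with a colimit, `colim.ι₁ : K₁ → colim K` coequalizes
`K(left), K(right)`. [cite: MochizukiSemiAnbd2006, Thm A.4 pp.82-86] -/
theorem colimit_ι_one_condition :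
    K.map left ≫ colimit.ι K one = K.map right ≫ colimit.ι K one := by
  rw [colimit.w K left, colimit.w K right]

/-- **`colim.ι₁ : K₁ → colim K` is a colimit cofork of `(K(left), K(right))`** — so the value
`ψ^*(X) = colim H(nerve X)` of the Čech extension is the COEQUALIZER of
`H(nerve X)(left), H(nerve X)(right)` with structure map `colim.ι₁`, the form in which the points of
`ψ^*(X)` are computed in `B^temp(Π₁)` (companion `BTempCoequalizerPoints.lean`).
[cite: MochizukiSemiAnbd2006, Thm A.4 pp.82-86] -/
noncomputable def colimitCoforkIsColimit :
    IsColimit (Cofork.ofπ (colimit.ι K one) (colimit_ι_one_condition K) :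
      Cofork (K.map left) (K.map right)) :=
  IsColimit.ofIsoColimit
    ((IsColimit.precomposeInvEquiv (diagramIsoParallelPair K) _).symm (colimit.isColimit K))
    (Cofork.ext (Iso.refl _) (by
      erw [Iso.refl_hom, Category.comp_id]
      simp [Cofork.π, diagramIsoParallelPair]))

namespace CechPresentation

variable {ι : Q ⥤ C} (P : CechPresentation ι) [HasColimitsOfShape WalkingParallelPair C']
  (H : Q ⥤ C')

/-- **`ψ^*(X)` as a coequalizer cofork**: `colim.ι₁ : H(nerve X)₁ → ψ^*(X)` is a colimit cofork of
`(H(nerve X(left)), H(nerve X(right)))`. [cite: MochizukiSemiAnbd2006, Thm A.4 pp.82-86] -/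
noncomputable def extensionCoforkIsColimit (X : C) :
    IsColimit (Cofork.ofπ (colimit.ι (P.nerve.obj X ⋙ H) one)
      (colimit_ι_one_condition (P.nerve.obj X ⋙ H)) :
      Cofork ((P.nerve.obj X ⋙ H).map left) ((P.nerve.obj X ⋙ H).map right)) :=
  colimitCoforkIsColimit (P.nerve.obj X ⋙ H)

/-- `ψ^*` on a morphism, against the cofork structure maps: `colim.ι₁ ≫ ψ^*(f) = H(nerve f)₁ ≫ colim.ι₁`.
[cite: MochizukiSemiAnbd2006, Thm A.4 pp.82-86] -/
theorem colimit_ι_extension_map {X Y : C} (f : X ⟶ Y) (j : WalkingParallelPair) :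
    colimit.ι (P.nerve.obj X ⋙ H) j ≫ (P.extension H).map f =
      H.map ((P.nerve.map f).app j) ≫ colimit.ι (P.nerve.obj Y ⋙ H) j :=
  ι_colimMap (Functor.whiskerRight (P.nerve.map f) H) j

end CechPresentation

end Cofork

end ThmA4Cech

end Literature.AnabelianGeometry.SemiGraphs
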